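import Summits.BirchSwinnertonDyer.BirchSwinnertonDyer.Theorems.ThetaPartnerAtTwoSignedControlAtTwoShaThreeBaseTransferTwo
import Literature.NumberTheory.NumberFields.PrescribedSignsCongruences
import Literature.NumberTheory.GaloisRepresentations.LocalWeilDatumValuation
import Mathlib.GroupTheory.IndexNormal
import HarnessLib

/-!
# K4 `SignedControlAtTwo`, base case of Milne I 4.10 (c)₃, brick B3: a totally positive non-square `e ∈ F` such that
# `F(√e)/F` is non-split at prescribed finite places (local index of `Γ_{F(√e)}` even)

Route `ThetaPartnerAtTwo` (TP2), crux K4 `SignedControlAtTwo` (stmt-BirchSwinnertonDyer-20309), line `eulerchar` v15, stub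
`stub_realThreeOrderTwoBase`; width seat `bsd-wall-tp2-p3-w2` gen 7 (`--supports stmt-BirchSwinnertonDyer-20309`, helper).
Brick B3 of `Cruxes/SignedControlAtTwo/HBASE-ROAD-w2g7.md` (the input `e` of bricks B2/`…ShaThreeBaseKillT` and N5–N7):

* `exists_smul_ne_of_not_mem_range_of_charZero` — over any field of characteristic `0`, an element of `K̄` outside `K` is moved by some
  `σ ∈ Γ_K` (`K̄/K` Galois);
* `two_dvd_index_comap_galFixing_adjoin_of_not_isSquare` — if `ε² = e` with `e` NOT a square in the completion `F_v`, the
  local index `[Γ_{F_v} : res_v⁻¹ Γ_{F(ε)}]` is even (it is `1` or `2` as `Γ_{F(ε)}` is normal of index `2`, and not `1`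
  because some `σ ∈ Γ_{F_v}` moves `ι_v ε`, whose square `e` is not a square in `F_v`);
* **`exists_totallyPositive_forall_two_dvd_localIndex`** — for every finite set `S` of finite places there are `e ∈ F` and
  `ε ∈ F̄` with `ε² = e`, `e` positive at every real embedding, `ε ∉ F`, and `2 ∣ [Γ_{F_v} : res_v⁻¹ Γ_{F(ε)}]` for `v ∈ S`
  (Tate's CRT element of the tree, `exists_ord_eq_and_valuation_sub_one_lt_and_pos`: `ord_v e = 1` on `S ∪ {v₀}`, `e` totally
  positive; odd order ⇒ non-square in `F_v`, `ord_mul`).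

HONEST FRAMING: THEOREMS ONLY (no definition, no named fact, no `sorry`); closes no item; BSD is not proved by any of this.
References: [NeukirchANT1999] Ch. II §3 Thm. (3.4) (approximation); [SerreGaloisCohomology1997] II §1.1; [MilneADT2006] I 4.10 (c).
-/

set_option autoImplicit false
-- the Theorems namespace of this sub repeats the summit name by design (D-0017 nested layout)
set_option linter.dupNamespace false

noncomputable section

open CategoryTheory Function Field NumberField IsDedekindDomain
open scoped NumberField Classical
open _root_.TopRep _root_.ContRepresentation _root_.ContinuousCohomology
open Literature.NumberTheory.GaloisRepresentations
open Literature.NumberTheory.GaloisRepresentations.LocalWeilDatum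
open Literature.NumberTheory.NumberFields

namespace Summit.BirchSwinnertonDyer.BirchSwinnertonDyer.Theorems.SignedEC.ShaThreeBase

section ChooseE

/-- Over a field `K` of characteristic `0`, an element of `K̄` fixed by every `σ ∈ Γ_K` lies in `K` (`K̄/K` Galois); contrapositive
form: an element outside `K` is moved by some `σ`. [cite: SerreGaloisCohomology1997, II §1.1] -/
theorem exists_smul_ne_of_not_mem_range_of_charZero {K : Type} [Field K] [CharZero K] (x : AlgebraicClosure K)
    (hx : x ∉ (algebraMap K (AlgebraicClosure K)).range) : ∃ σ : absoluteGaloisGroup K, σ • x ≠ x := by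
  by_contra hall
  apply hx
  haveI : IsGalois K (AlgebraicClosure K) := IsGalois.mk
  have hmem : x ∈ (⊥ : IntermediateField K (AlgebraicClosure K)) := by
    rw [← InfiniteGalois.fixedField_fixingSubgroup (⊥ : IntermediateField K (AlgebraicClosure K)),
      IntermediateField.fixingSubgroup_bot, IntermediateField.mem_fixedField_iff]
    intro g _
    by_contra h
    exact hall ⟨g, h⟩
  obtain ⟨a, ha⟩ := IntermediateField.mem_bot.mp hmem
  exact ⟨a, ha⟩

variable {F : Type} [Field F] [NumberField F]

/-- **Even local index**: if `ε² = e ∈ F` and `e` is not a square in the completion `F_v`, then `2` divides the index of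
`res_v⁻¹(Γ_{F(ε)})` in `Γ_{F_v}` (the index is `1` or `2` since `Γ_{F(ε)}` is normal of index `2`; it is not `1`: an
element of `Γ_{F_v}` moving `ι_v ε` — which is not in `F_v` as its square `e` is not a square there — restricts outside
`Γ_{F(ε)}`). [cite: SerreGaloisCohomology1997, II §1.1] -/
theorem two_dvd_index_comap_galFixing_adjoin_of_not_isSquare (e : F) (ε : AlgebraicClosure F)
    (hε : ε * ε = algebraMap F _ e) (hεF : ε ∉ (algebraMap F (AlgebraicClosure F)).range)
    (v : HeightOneSpectrum (𝓞 F)) (hsq : ¬ IsSquare (algebraMap F (v.adicCompletion F) e)) :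
    2 ∣ ((galFixing F (IntermediateField.adjoin F {ε})).comap ((absGaloisRestrict F (v.adicCompletion F) :
      absoluteGaloisGroup (v.adicCompletion F) →ₜ* absoluteGaloisGroup F) :
      absoluteGaloisGroup (v.adicCompletion F) →* absoluteGaloisGroup F)).index := by
  haveI : CharZero (v.adicCompletion F) := charZero_of_injective_algebraMap (algebraMap F (v.adicCompletion F)).injective
  set U := galFixing F (IntermediateField.adjoin F {ε}) with hU
  have hidx : U.index = 2 := index_galFixing_adjoin_eq_two e ε hε hεF
  haveI : U.Normal := Subgroup.normal_of_index_eq_two hidx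
  set f : absoluteGaloisGroup (v.adicCompletion F) →* absoluteGaloisGroup F :=
    ((absGaloisRestrict F (v.adicCompletion F) : absoluteGaloisGroup (v.adicCompletion F) →ₜ* absoluteGaloisGroup F) :
      absoluteGaloisGroup (v.adicCompletion F) →* absoluteGaloisGroup F) with hf
  -- the index is `1` or `2`
  have hdvd : (U.comap f).index ∣ 2 := by
    rw [Subgroup.index_comap, ← hidx]
    exact Subgroup.relIndex_dvd_index_of_normal U f.range
  -- it is not `1`: some `σ ∈ Γ_{F_v}` moves `ι ε`
  have hne : (U.comap f).index ≠ 1 := by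
    intro h1
    rw [Subgroup.index_eq_one] at h1
    -- `ι ε` is fixed by all of `Γ_{F_v}`, hence lies in `F_v`
    set ι := absClosureEmbedding F (v.adicCompletion F) with hι
    have hfix : ∀ σ : absoluteGaloisGroup (v.adicCompletion F), σ • ι ε = ι ε := fun σ => by
      have hσ : f σ ∈ U := by rw [← Subgroup.mem_comap, h1]; exact Subgroup.mem_top σ
      have hσε : absGaloisRestrict F (v.adicCompletion F) σ • ε = ε := (mem_galFixing_adjoin_simple_iff ε _).1 hσ
      rw [← absGaloisRestrict_apply_smul, hσε]
    obtain ⟨z, hz⟩ := not_not.1 (fun h => (exists_smul_ne_of_not_mem_range_of_charZero (ι ε) h).elim fun σ hσ => hσ (hfix σ))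
    apply hsq
    refine ⟨z, (algebraMap (v.adicCompletion F) (AlgebraicClosure (v.adicCompletion F))).injective ?_⟩
    rw [map_mul, hz, ← map_mul, hε, AlgHom.commutes]
    exact (IsScalarTower.algebraMap_apply F (v.adicCompletion F) (AlgebraicClosure (v.adicCompletion F)) e)
  rcases (Nat.dvd_prime Nat.prime_two).1 hdvd with h | h
  · exact absurd h hne
  · rw [h]

/-- An element of `F` whose image in `F_v` has `ord_v = 1` is not a square in `F_v` (`ord (z²) = 2 ord z`). [folklore] -/
theorem not_isSquare_adicCompletion_of_ord_eq_one (v : HeightOneSpectrum (𝓞 F)) {e : F} (he : e ≠ 0)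
    (hord : ord (v.adicCompletion F) (algebraMap F (v.adicCompletion F) e) = 1) :
    ¬ IsSquare (algebraMap F (v.adicCompletion F) e) := by
  rintro ⟨z, hz⟩
  have hz0 : z ≠ 0 := by
    rintro rfl
    rw [mul_zero, map_eq_zero_iff _ (algebraMap F (v.adicCompletion F)).injective] at hz
    exact he hz
  rw [hz, ord_mul (v.adicCompletion F) hz0 hz0] at hord
  omega

omit [NumberField F] in
/-- A real embedding of a number field is the embedding of a real place, so positivity at every real place (in the
`extensionEmbeddingOfIsReal` form of the tree's approximation theorem) gives positivity under every `φ : F →+* ℝ`. [folklore] -/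
theorem pos_of_forall_isReal_pos {a : F}
    (h : ∀ (w : InfinitePlace F) (hw : w.IsReal),
      0 < InfinitePlace.Completion.extensionEmbeddingOfIsReal hw (algebraMap F w.Completion a)) (φ : F →+* ℝ) :
    0 < φ a := by
  set w : InfinitePlace F := InfinitePlace.mk (Complex.ofRealHom.comp φ) with hw
  have hreal : ComplexEmbedding.IsReal (Complex.ofRealHom.comp φ) := by
    ext x; simp
  have hwr : w.IsReal := ⟨Complex.ofRealHom.comp φ, hreal, rfl⟩
  have h1 := h w hwr
  rw [show (algebraMap F w.Completion a) = ((WithAbs.equiv w.1).symm a : WithAbs w.1) from rfl,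
    InfinitePlace.Completion.extensionEmbeddingOfIsReal_coe] at h1
  have hemb : (InfinitePlace.embedding_of_isReal hwr : F →+* ℝ) = φ := by
    have h2 : w.embedding = Complex.ofRealHom.comp φ := by
      rw [hw, NumberField.InfinitePlace.embedding_mk_eq_of_isReal hreal]
    ext x
    have h3 := congrArg (fun ψ : F →+* ℂ => (ψ x).re) h2
    simp only [RingHom.coe_comp, Function.comp_apply, Complex.ofRealHom_eq_coe, Complex.ofReal_re] at h3
    rw [← h3, ← NumberField.InfinitePlace.embedding_of_isReal_apply hwr x, Complex.ofReal_re]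
  rw [hemb] at h1
  simpa using h1

/-- **Brick B3**: for every finite set `S` of finite places of a number field `F` there are `e ∈ F` and `ε ∈ F̄` with `ε² = e`,
`e` positive under every real embedding, `ε ∉ F`, and `2 ∣ [Γ_{F_v} : res_v⁻¹ Γ_{F(ε)}]` for every `v ∈ S` (take the tree's
totally positive CRT element with `ord_v e = 1` on `S ∪ {v₀}`). [cite: NeukirchANT1999, Ch. II §3 Thm. (3.4)]
[cite: MilneADT2006, Ch. I, Thm. 4.10 (c)] -/
theorem exists_totallyPositive_forall_two_dvd_localIndex (S : Finset (HeightOneSpectrum (𝓞 F))) :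
    ∃ (e : F) (ε : AlgebraicClosure F), ε * ε = algebraMap F _ e ∧ (∀ φ : F →+* ℝ, 0 < φ e) ∧
      ε ∉ (algebraMap F (AlgebraicClosure F)).range ∧
      ∀ v ∈ S, 2 ∣ ((galFixing F (IntermediateField.adjoin F {ε})).comap
        ((absGaloisRestrict F (v.adicCompletion F) : absoluteGaloisGroup (v.adicCompletion F) →ₜ* absoluteGaloisGroup F) :
        absoluteGaloisGroup (v.adicCompletion F) →* absoluteGaloisGroup F)).index := by
  classical
  -- a finite place `v₀` (the ring of integers is not a field)
  obtain ⟨p, hp0, hp⟩ := Ring.not_isField_iff_exists_prime.1 (NumberField.RingOfIntegers.not_isField (K := F))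
  let v₀ : HeightOneSpectrum (𝓞 F) := ⟨p, hp, hp0⟩
  set S' := insert v₀ S with hS'
  obtain ⟨e, he0, hord, -, hpos⟩ := exists_ord_eq_and_valuation_sub_one_lt_and_pos F S' ∅ (Finset.disjoint_empty_right _)
    (fun _ => 1)
  obtain ⟨ε, hε⟩ := IsAlgClosed.exists_eq_mul_self (algebraMap F (AlgebraicClosure F) e)
  have hsqv : ∀ v ∈ S', ¬ IsSquare (algebraMap F (v.adicCompletion F) e) := fun v hv =>
    not_isSquare_adicCompletion_of_ord_eq_one v he0 (by exact_mod_cast hord v hv)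
  have hεF : ε ∉ (algebraMap F (AlgebraicClosure F)).range := by
    rintro ⟨c, hc⟩
    apply hsqv v₀ (Finset.mem_insert_self _ _)
    refine ⟨algebraMap F _ c, ?_⟩
    rw [← map_mul]
    congr 1
    exact (algebraMap F (AlgebraicClosure F)).injective (by rw [map_mul, hc, ← hε])
  refine ⟨e, ε, hε.symm, pos_of_forall_isReal_pos hpos, hεF, fun v hv => ?_⟩
  exact two_dvd_index_comap_galFixing_adjoin_of_not_isSquare e ε hε.symm hεF v (hsqv v (Finset.mem_insert_of_mem hv))

end ChooseE

end Summit.BirchSwinnertonDyer.BirchSwinnertonDyer.Theorems.SignedEC.ShaThreeBase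

end
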